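import Summits.ResolutionOfSingularities.ResolutionOfSingularities.Theorems.FrobeniusClosingPatchingRelPerfectDepthMultiHostCyl
import Summits.ResolutionOfSingularities.ResolutionOfSingularities.Theorems.FrobeniusClosingPatchingRelPerfectDepthMultiHostCJSTransportStep
import Summits.ResolutionOfSingularities.ResolutionOfSingularities.Theorems.FrobeniusClosingPatchingRelPerfectDepthMultiHostFormatSnc
import Summits.ResolutionOfSingularities.ResolutionOfSingularities.Theorems.FrobeniusClosingPatchingRelPerfectDepthGradedTargets
import Literature.Topology.KrullDimensionDrop
import Summits.ResolutionOfSingularities.ResolutionOfSingularities.Theorems.FrobeniusClosingPatchingRelPerfectDepthMultiHostResidual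
import Summits.ResolutionOfSingularities.ResolutionOfSingularities.Theorems.FrobeniusClosingPatchingRelPerfectDepthMultiHostEnd
import HarnessLib

/-!
# Crux `PatchingRelPerfect` (stmt-ResolutionOfSingularities-16161), chain W5.2 — TYPED TARGETS v6 for F7(β) (β-AX) d = 2, the SIBLING OF RECORD
# (supersedes `ChainW52TargetsF7Beta.lean` p552304 per res-L1-w52-plan-1 RULING G11-41 / G11-46): `StepStable` (+ LOWER BOUND) · T2 `CJSTransport₂` ·
# T2c `FormatEndOnCyl₂` · T0 `InitialMultiHost₂` · `InitialShape` · `AtlasInitial` (+ generation-1 antecedents) · T3 `PhaseCTermination₂` ·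
# `BetaTwoAtomConclusion₂` · T5 statement `BetaTwoComposition₂` · C-I `PhaseCOne`

[OURS · L1 W5.2 · F7(β) (β-AX)] Statements (Props) only — the typed targets of the (β-AX) assembly, TEXT OF RECORD v6; NOT statements of the
manuscript under review; candidates, not facts; AI-written, weaker than expert review.  AUTHOR of the statements: res-L1-w52-plan-1 g11, targets
scratch v6 `L/res-L1-w52-plan-1/ChainW52TargetsF7BetaR.scratch.lean` sha16 b1267c9c96a75e97 (RULINGs G11-41/42/43/46; farm rc 0 · 0 · 0 · 0;
res-L1-w52-tri-2 FIRST-STEP PASS 18:16:30Z; res-D-pv-054΄s 18:11:20Z form (B) of the lower bound upheld).  FILED VERBATIM (statements untouched;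
this header replaces the scratch header) by res-D-repro-1 AS res-L1-repro-3 on NAMING G11-46.  **v6 = v5 (tree `Theorems/ChainW52TargetsF7Beta.lean`
p552304, namespace `ChainW52F7Beta`) VERBATIM under the NEW namespace `ChainW52F7BetaR`, except:** (i) `StepStable` gains the LOWER BOUND for the new
cylinder region (res-L1-w52-lead-1 SHRINK FINDING 17:57:34Z, RULING G11-41; ideal-level GLOBAL form (B), G11-46): `τ⁻¹(cyl.V) ∖ cyl′.V` lies in the
cosupport of the weight-one controlled transform of the globalised cylinder ideal `(C.comap cyl.q).map cyl.V.ι` over the centre — so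
`X′ ∖ V′ = τ⁻¹(X ∖ V) ∪ (pole section ∪ frozen strata)` exactly and pole clauses are step-stable; (ii) `AtlasInitial` gains the GENERATION-1
antecedents incl. `InitialShape` (res-L1-w52-tri-2 AE5: else `CylReach` contains junk states and T3 is of resolution strength); (iii) `PhaseCOne P`
(RULING G11-36: T3 split `PhaseCOne P → PhaseCTermination₂ P`, C-II = tree T4 on the residual) is included.  Landed modules are never amended:
p552304 stays in the tree unreferenced; consumers (res-D-pv-054 `cjsTransport₂_of_cjsB`, res-L1-w52-lead-1 `…DepthPhaseCAtlas`, res-D-pv-021 EndTail,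
res-D-pv-055 T0, the T5 twin `…DepthBetaTwoCompositionR`) import THIS module.  No instances, no notation, no facts; review lane (definitions).
-/

noncomputable section

open CategoryTheory CategoryTheory.Limits AlgebraicGeometry TopologicalSpace IsLocalRing
open Literature.AlgebraicGeometry.Resolution Scheme.IdealSheafData
open Literature.AlgebraicGeometry.Hironaka2017.MonomialPart Literature.AlgebraicGeometry.Motives

set_option linter.dupNamespace false

namespace Summit.ResolutionOfSingularities.ResolutionOfSingularities.Theorems

universe u

namespace ChainW52F7BetaR

open DepthMultiHost

/-- [OURS · L1 W5.2] **STEP-STABILITY of a cylinder-state predicate `P`** (RULING G11-24; binder text VERBATIM = res-D-pv-054΄s `hP`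
in `MultiHostCJS.transport_of_cjsB`, scratch b2c5637f8a6575fe): `P` survives one lifted cylinder step with all its data and relations.
The POLE-STRUCTURE predicate of T3 (idea-1 P3: the pole-chart atlas off `cyl.V`, incl. the frozen-cylinder regions, NOTE G11-26) is
supplied as such a `P`; the transport calls `hP` only with `ν = 0` and `m` = generic orders. **v5 (NOTE G11-26 (2) / G11-29): RESTRICTED** —
`ν := 0` literally (total-transform bookkeeping) and `m` MAXIMAL (`∀ i, ¬ cyl.tr i ≤ C ^ (m i + 1)`); res-D-pv-054΄s 1″/Loop/Transport adopt this text verbatim. **v6 (RULING G11-41; ideal-level GLOBAL form (B) of res-D-pv-054 18:11:20Z: what `τ⁻¹V` loses lies in the support of the weak transform of the GLOBALISED cylinder ideal `(C.comap cyl.q).map cyl.V.ι` — the set-level closure picture (A) follows where used, via `strictTransformIdeal_eq_controlledTransform_of_isRegular_subscheme`): + the LOWER BOUND `τ ⁻¹' cyl.V \\ cyl'.V ⊆ support (controlledTransform τ 𝓘_W ((C.comap cyl.q).map cyl.V.ι) 1)`** (the bound res-D-pv-054΄s `retractLiftOpen` has: off the strict transform of the cylinder `q⁻¹(V(C))` the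 retraction lifts). -/
def StepStable (P : ∀ ⦃X : Scheme.{u}⦄ (S : MultiHostState X), CylState S → Prop) : Prop :=
  ∀ ⦃X X' : Scheme.{u}⦄ [IsLocallyNoetherian X] [IsLocallyNoetherian X'] (S : MultiHostState X)
    (cyl : CylState S) [IsIntegral cyl.Z] [IsNoetherian cyl.Z] (C : cyl.Z.IdealSheafData), C ≠ ⊥ →
    Scheme.IsRegular C.subscheme → C = vanishingIdeal C.support →
    ∀ (𝓑 : List cyl.Z.IdealSheafData), (∀ T ∈ S.𝓔, T ≠ cyl.j.ker → cyl.bd T ∈ 𝓑) → HasSNCWith 𝓑 C →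
    ∀ (τ : X' ⟶ X) (hτ : IsBlowup τ (vanishingIdeal (cyl.centre C))) (η : X), IsGenericPoint η (cyl.centre C : Set X) →
    ∀ (m : Fin S.n → ℕ), (∀ i, cyl.tr i ≤ C ^ m i) → (∀ i, ¬ cyl.tr i ≤ C ^ (m i + 1)) →
    ∀ (hsncX : HasSNCWith S.𝓔 (vanishingIdeal (cyl.centre C)))
      (cyl' : CylState (S.step τ (cyl.centre C) η m 0 hsncX hτ)) (τZ : cyl'.Z ⟶ cyl.Z),
      IsBlowup τZ C → cyl'.j ≫ τ = τZ ≫ cyl.j →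
      cyl'.j.ker = strictTransformIdeal τ (vanishingIdeal (cyl.centre C)) cyl.j.ker →
      (∀ i, cyl'.tr i = controlledTransform τZ C (cyl.tr i) (m i)) →
      (∀ T ∈ S.𝓔, T ≠ cyl.j.ker →
        cyl'.bd (strictTransformIdeal τ (vanishingIdeal (cyl.centre C)) T) = strictTransformIdeal τZ C (cyl.bd T)) →
      cyl'.bd ((vanishingIdeal (cyl.centre C)).comap τ) = C.comap τZ → ((cyl'.V : Set X') ⊆ τ ⁻¹' (cyl.V : Set X)) →
      (τ ⁻¹' (cyl.V : Set X) \ (cyl'.V : Set X') ⊆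
        ((controlledTransform τ (vanishingIdeal (cyl.centre C)) ((C.comap cyl.q).map cyl.V.ι) 1).support : Set X')) →
      P S cyl → P (S.step τ (cyl.centre C) η m 0 hsncX hτ) cyl'

/-- [OURS · L1 W5.2] **T2 `CJSTransport₂`** — the X-side transport of ONE F-32bR run on the carrier of a boundary-free cylinder
state (res-D-pv-054 `MultiHostCJS.transport_of_cjsB`, modulo the lift hypothesis `hlift` = X2a module 2 and the named fact
`CossartJannsenSaito2020EmbeddedSequenceB`). -/
def CJSTransport₂ : Prop :=
  ∀ (P : ∀ ⦃X : Scheme.{u}⦄ (S : MultiHostState X), CylState S → Prop), StepStable P →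
  ∀ {X₀ : Scheme.{u}} [IsNoetherian X₀], Scheme.IsRegular X₀ → ∀ (S₀ : MultiHostState X₀) (cyl₀ : CylState S₀)
    [IsIntegral cyl₀.Z] [IsNoetherian cyl₀.Z], Scheme.IsRegular cyl₀.Z → Scheme.IsExcellent cyl₀.Z →
    topologicalKrullDim cyl₀.Z = 3 → (∀ T ∈ S₀.𝓔, T = cyl₀.j.ker) → P S₀ cyl₀ →
    ∃ (X₁ : Scheme.{u}) (π : X₁ ⟶ X₀) (_ : IsNoetherian X₁) (S₁ : MultiHostState X₁) (cyl₁ : CylState S₁)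
      (ρ : cyl₁.Z ⟶ cyl₀.Z) (_ : IsIntegral cyl₁.Z) (_ : IsNoetherian cyl₁.Z) (𝓔 : List cyl₁.Z.IdealSheafData),
      P S₁ cyl₁ ∧ (∃ Q : X₀.IdealSheafData, IsBlowup π Q ∧ (Q.support : Set X₀) ⊆ Set.range cyl₀.j) ∧
      Scheme.IsRegular X₁ ∧ S₁.K = S₀.K.comap π ∧ S₁.n = S₀.n ∧ cyl₁.j ≫ π = ρ ≫ cyl₀.j ∧
      Scheme.IsRegular cyl₁.Z ∧
      HasSNC 𝓔 ∧ 𝓔.Nodup ∧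
      (∀ T ∈ 𝓔, T ≠ ⊤ → ∃ ζ : cyl₁.Z, T = vanishingIdeal ⟨closure {ζ}, isClosed_closure⟩) ∧
      (∀ T ∈ 𝓔, T ≠ ⊤ → IsIrreducible (T.support : Set cyl₁.Z)) ∧
      (∀ T ∈ S₁.𝓔, T ≠ cyl₁.j.ker → cyl₁.bd T ∈ 𝓔) ∧
      (∀ i, ∃ c : cyl₁.Z.IdealSheafData → ℕ, cyl₁.tr i = monomialIdeal (𝓔.map fun T => (T, c T)))

/-- [OURS · L1 W5.2] **T2c `FormatEndOnCyl₂`** — at CJS end the state is in STRICT FORMAT-SNC END on the cylinder open: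
from ONE snc family `𝓔` on the carrier presenting the boundary traces and every host trace as a monomial, the carrier and
the cylinders over `𝓔` form the format family on `cyl.V` (CYL-SNC from `CylState.param`, NOTE G11-22) and every host is the
monomial of the cylinders. Output currency = `MultiHostState.IsFormatSncOn` (p546954). -/
def FormatEndOnCyl₂ : Prop :=
  ∀ {X : Scheme.{u}} [IsNoetherian X], Scheme.IsRegular X → ∀ (S : MultiHostState X) (cyl : CylState S)
    [IsIntegral cyl.Z] [IsNoetherian cyl.Z], Scheme.IsRegular cyl.Z → ∀ (𝓔 : List cyl.Z.IdealSheafData),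
    HasSNC 𝓔 → 𝓔.Nodup →
    (∀ T ∈ 𝓔, T ≠ ⊤ → IsIrreducible (T.support : Set cyl.Z)) →
    (∀ T ∈ S.𝓔, T ≠ cyl.j.ker → cyl.bd T ∈ 𝓔) →
    (∀ i, ∃ c : cyl.Z.IdealSheafData → ℕ, cyl.tr i = monomialIdeal (𝓔.map fun T => (T, c T))) →
    ∃ (𝓒 : List X.IdealSheafData) (𝓗 : Fin S.n → List (X.IdealSheafData × ℕ)), S.IsFormatSncOn cyl.V 𝓒 𝓗

/-- [OURS · L1 W5.2] **T0 `InitialMultiHost₂`** — the INITIAL CYLINDER STATE of a (β) d = 2 graded member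
`I = (P_j(x))_j + (x_k^4)_k` (quadratic forms `P_j` over a coefficient field `κ₀` of the regular local fourfold `S`): on
`X₁ = Bl_𝔪 Spec S` the depth-two invariant holds for a residual ideal `K` which is the ideal of a boundary-free multi-host state
`St` (hosts = cylinders over the quadrics `V₊(P_j) ⊂ E ≅ ℙ³_{κ₀}` plus the pure N-summand `𝓘_E²`) carried by a cylinder
state `cyl` whose carrier is (the image of) `E` — PACKAGING over `gradedPackagePow_holds` / `DepthOne.exists_retraction` /
`gradedHostPackagePow_single` plus PARAM at every point (spec v4.2 §7 A2/A3; hand res-D-pv-055). v2 (16:58Z): `IsAdicComplete` binder allowed (Q-T0-1) —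
the CORE binder supplies it; used only to read `κ₀[x]_{(x)} → S` as a completion map (regular fibres off `E`). v4 (RULING G11-27):
`Z := ℙ³, j := i, V := ⊤, q := ⊤.ι ≫ R₀`; extra conjuncts `Scheme.IsExcellent X` (`isExcellentRing_of_isAdicComplete` +
`Scheme.isExcellent_Spec_of_isExcellentRing` + `IsBlowup.isExcellent`), `St.n ≠ 0` (there is the `⊤` host) and `cyl.V = ⊤` (feeds `AtlasInitial`).
v5 (Q-T0-3, res-D-pv-055): binder `∀ j, P j ≠ 0` (host traces must be effective Cartier); T5 reduces a general family to its non-zero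
sub-family (`gradedMemberIdeal` ignores zero forms; the all-zero member is the pure monomial `(x_k^4)`, support lemma). -/
def InitialMultiHost₂ : Prop :=
  ∀ (S : Type u) [CommRing S] [IsRegularLocalRing S] [IsAdicComplete (IsLocalRing.maximalIdeal S) S],
    ringKrullDim S = (4 : ℕ) →
  ∀ (κ₀ : Type u) [Field κ₀] (σ : κ₀ →+* S), Function.Bijective ⇑((IsLocalRing.residue S).comp σ) →
  ∀ (x : Fin 4 → S), Ideal.span (Set.range x) = IsLocalRing.maximalIdeal S →
  ∀ (s : ℕ) (P : Fin s → MvPolynomial (Fin 4) κ₀)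
    (hP : ∀ j, P j ∈ MvPolynomial.homogeneousSubmodule (Fin 4) κ₀ 2), (∀ j, P j ≠ 0) →
    ∃ (X : Scheme.{u}) (g : X ⟶ Spec (.of S)) (i : ProjSpace.P 3 κ₀ ⟶ X) (K : X.IdealSheafData)
      (_ : IsNoetherian X) (St : MultiHostState X) (cyl : CylState St) (_ : IsIntegral cyl.Z) (_ : IsNoetherian cyl.Z),
      DepthTargets.DepthInvariant 2 S (DepthTargets.gradedMemberIdeal σ x 2 2 P) (ProjSpace.P 3 κ₀) X i g K ∧
      Scheme.IsExcellent X ∧ St.K = K ∧ St.n ≠ 0 ∧ (∀ T ∈ St.𝓔, T = cyl.j.ker) ∧ Set.range cyl.j.base ⊆ Set.range i.base ∧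
      cyl.V = ⊤ ∧ Scheme.IsRegular cyl.Z ∧ Scheme.IsExcellent cyl.Z ∧ topologicalKrullDim cyl.Z = 3

/-- [OURS · L1 W5.2] **GENERATION-1 SHAPE of a cylinder state** (v6, res-L1-w52-tri-2 FINDING AE5 18:08:23Z): `(St, cyl)` IS a T0 output —
its ideal is the `DepthInvariant 2` transform of a (β) d = 2 graded member ideal of a complete regular local fourfold with perfect-type
coefficient field, read through a chart `i : ℙ³ ⟶ X` containing the carrier (the K-content of `InitialMultiHost₂`΄s conclusion, verbatim).
Without this antecedent `AtlasInitial` would force every admissible `P` (and `CylReach`) onto junk V = ⊤ states of every shape. -/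
def InitialShape ⦃X : Scheme.{u}⦄ (St : MultiHostState X) (cyl : CylState St) : Prop :=
  ∃ (S : Type u) (_ : CommRing S) (_ : IsRegularLocalRing S) (_ : IsAdicComplete (IsLocalRing.maximalIdeal S) S)
    (_ : ringKrullDim S = (4 : ℕ)) (κ₀ : Type u) (_ : Field κ₀) (σ : κ₀ →+* S)
    (_ : Function.Bijective ⇑((IsLocalRing.residue S).comp σ)) (x : Fin 4 → S)
    (_ : Ideal.span (Set.range x) = IsLocalRing.maximalIdeal S) (s : ℕ) (P : Fin s → MvPolynomial (Fin 4) κ₀)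
    (_ : ∀ j, P j ∈ MvPolynomial.homogeneousSubmodule (Fin 4) κ₀ 2) (_ : ∀ j, P j ≠ 0)
    (g : X ⟶ Spec (.of S)) (i : ProjSpace.P 3 κ₀ ⟶ X),
    DepthTargets.DepthInvariant 2 S (DepthTargets.gradedMemberIdeal σ x 2 2 P) (ProjSpace.P 3 κ₀) X i g St.K ∧
      Set.range cyl.j.base ⊆ Set.range i.base

/-- [OURS · L1 W5.2] **Initial validity of a pole-atlas predicate** (v6): `P` holds of every GENERATION-1 cylinder state — cylinder
region ALL of `X` (RULING G11-27 (4)), regular excellent three-dimensional carrier, boundary family = [carrier], a summand, excellent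
`X`, and `InitialShape` (res-L1-w52-tri-2 AE5: the antecedents T0 actually delivers; without them the least admissible predicate
`CylReach` would contain junk states and `PhaseCTermination₂ CylReach` would be of resolution strength). Supplies T5΄s `h₀ : P S₀ cyl₀`
(all antecedents are conjuncts of `InitialMultiHost₂`΄s conclusion). -/
def AtlasInitial (P : ∀ ⦃X : Scheme.{u}⦄ (S : MultiHostState X), CylState S → Prop) : Prop :=
  ∀ ⦃X : Scheme.{u}⦄ [IsNoetherian X] (St : MultiHostState X) (cyl : CylState St) [IsIntegral cyl.Z] [IsNoetherian cyl.Z],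
    cyl.V = ⊤ → Scheme.IsRegular cyl.Z → Scheme.IsExcellent cyl.Z → topologicalKrullDim cyl.Z = 3 →
    (∀ T ∈ St.𝓔, T = cyl.j.ker) → Scheme.IsExcellent X → St.n ≠ 0 → InitialShape St cyl → P St cyl


/-- [OURS · L1 W5.2] **T3 `PhaseCTermination₂ P` — PHASE C (X3), ∃-form, RESIDUAL CURRENCY** (RULING G11-25 A8/A9, spec v4.3 §8;
design owner res-L1-w52-idea-1, typer res-L1-w52-lead-1). For the pole-atlas predicate `P` (idea-1 P3; `StepStable P`,
`AtlasInitial P`): a multi-host state `S` on regular excellent Noetherian `X`, FORMAT-SNC on the cylinder region `cyl.V` (T2c) and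
satisfying `P S cyl` off it, admits a finite sequence `s` of blowings up in REGULAR centres over `cosupp S.K` with regular top on
which the transform of `K` FACTORS as `M · K♭` — `M` effective Cartier (the member-wise minimal monomial, pulled back) and `K♭ = S♭.K`
the ideal of a multi-host state with as many hosts, FORMAT-SNC on an open `U′ ⊇ cosupp K♭` (res-L1-repro-3΄s `S′.residual` is the
canonical `S♭`; `…DepthMultiHostResidual`). Phase C PUSHES THE RESIDUAL COSUPPORT INTO A FORMAT-SNC OPEN: (P-reg) poles reach strict END
(Lemma R/E, Φ-descent, S1♯ with TB1/TB2, tail lemma) and are included in `U′` or principalised locally; (P-cone) poles (an axis host)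
never reach END — the residual is emptied there by order arithmetic; frozen-cylinder regions (NOTE G11-26) by cylindrified
principalisation of the pre-step residual shadow. T5 then applies E1 `isEndOn_of_isFormatSncOn` + T4 `IsEndOn.exists_centreSeq` to `S♭`
VERBATIM and multiplies back by `M`. -/
def PhaseCTermination₂ (P : ∀ ⦃X : Scheme.{u}⦄ (S : MultiHostState X), CylState S → Prop) : Prop :=
  ∀ {X : Scheme.{u}} [IsNoetherian X], Scheme.IsRegular X → Scheme.IsExcellent X →
  ∀ (S : MultiHostState X) (cyl : CylState S) [IsIntegral cyl.Z] [IsNoetherian cyl.Z],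
    Scheme.IsRegular cyl.Z → S.n ≠ 0 →
  ∀ (𝓒 : List X.IdealSheafData) (𝓗 : Fin S.n → List (X.IdealSheafData × ℕ)),
    S.IsFormatSncOn cyl.V 𝓒 𝓗 → P S cyl →
    ∃ (s : CentreSeq X), s.AllRegular ∧ s.CentresOver (S.K.support : Set X) ∧ Scheme.IsRegular s.top ∧
      ∃ (_ : IsNoetherian s.top) (M : s.top.IdealSheafData) (Sf : MultiHostState s.top),
        S.K.comap s.comp = M * Sf.K ∧ IsEffectiveCartier M ∧ Sf.n ≠ 0 ∧
        ∃ (U' : s.top.Opens) (𝓒' : List s.top.IdealSheafData) (𝓗' : Fin Sf.n → List (s.top.IdealSheafData × ℕ)),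
          Sf.IsFormatSncOn U' 𝓒' 𝓗' ∧ (Sf.K.support : Set s.top) ⊆ (U' : Set s.top)

/-- [OURS · L1 W5.2] **T5΄s conclusion — the CORE atom conclusion for (β) d = 2 graded members over a COMPLETE regular local fourfold
with a coefficient field**: `I = (P_j(x))_j + (x_k^4)_k ≠ 0`, `P_j` quadratic forms; every `T = Bl_I Spec S` has ONE further blowing up
along a non-zero ideal cosupported over the closed point with regular source (shape of `DepthTargets.gradedMember_atomConclusion`,
m = 3, d = ℓ = 2). -/
def BetaTwoAtomConclusion₂ : Prop :=
  ∀ (S : Type u) [CommRing S] [IsRegularLocalRing S] [IsAdicComplete (IsLocalRing.maximalIdeal S) S],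
    ringKrullDim S = (4 : ℕ) →
  ∀ (κ₀ : Type u) [Field κ₀] (σ : κ₀ →+* S), Function.Bijective ⇑((IsLocalRing.residue S).comp σ) →
  ∀ (x : Fin 4 → S), Ideal.span (Set.range x) = IsLocalRing.maximalIdeal S →
  ∀ (s : ℕ) (P : Fin s → MvPolynomial (Fin 4) κ₀)
    (_ : ∀ j, P j ∈ MvPolynomial.homogeneousSubmodule (Fin 4) κ₀ 2),
    DepthTargets.gradedMemberIdeal σ x 2 2 P ≠ ⊥ →
  ∀ (T : Scheme.{u}) (f : T ⟶ Spec (.of S)),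
    IsBlowup f (affineBlowup.idealSheaf (DepthTargets.gradedMemberIdeal σ x 2 2 P)) →
    ∃ (J : T.IdealSheafData) (T' : Scheme.{u}) (π : T' ⟶ T), J ≠ ⊥ ∧
      (∀ t : T, t ∈ J.support → f.base t = IsLocalRing.closedPoint S) ∧
      IsBlowup π J ∧ Scheme.IsRegular T'

/-- [OURS · L1 W5.2] **T5 `betaTwo_atomConclusion_of_targets` — the COMPOSITION STATEMENT** (to be PROVED in `ChainW52TargetsF7Beta.lean`
or a sibling by the T5 typer; pattern `atomConclusion_of_tower`, `…TowerContraction` l.114): T0, T2, T2c and ONE pole atlas `P` with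
`StepStable P`, `AtlasInitial P`, `PhaseCTermination₂ P` give the (β) d = 2 atom conclusion. The final closer reads
`… (hCJS : CossartJannsenSaito2020EmbeddedSequenceB) := betaTwo_atomConclusion_of_targets T0_holds (cjsTransport₂_of_cjsB hlift hCJS) T2c_holds ⟨P, hP, hP₀, hC⟩`. -/
def BetaTwoComposition₂ : Prop :=
  InitialMultiHost₂.{u} → CJSTransport₂.{u} → FormatEndOnCyl₂.{u} →
    (∃ P : ∀ ⦃X : Scheme.{u}⦄ (S : MultiHostState X), CylState S → Prop,
      StepStable P ∧ AtlasInitial P ∧ PhaseCTermination₂ P) →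
    BetaTwoAtomConclusion₂.{u}

/-!
## Pending (not typed here)
* (TYPED above in v4 — kept for the record) **T3 `PhaseCTermination₂`** (X3, ∃-form; RULING G11-25 A8/A9 RESIDUAL CURRENCY; the atlas `P` itself = idea-1 g12 P3):
  input = a state `S` on regular Noetherian excellent `X` with `S.IsFormatSncOn V 𝓒 𝓗` on the cylinder open `V` (T2c) and
  `P S cyl` for the POLE-CHART ATLAS predicate `P` (step-stable, `StepStable P`; it describes `X ∖ V`: pole sections σ_k(C_k) on the
  k-th exceptional member AND the frozen-cylinder regions `Cyl(C_k)˜ ∩ (older members)` — NOTE G11-26); output =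
  `∃ s : CentreSeq X` (AllRegular, every centre inside the exceptional members, i.e. over `cosupp S.K`) and a state `S′` on `s.top`
  with `S′.K = S.K.comap s.comp`, `S′.n = S.n`, and `∃ U′ 𝓒′ 𝓗′, S′.IsFormatSncOn U′ 𝓒′ 𝓗′ ∧ cosupp S′.residual.K ⊆ U′`
  (`MultiHostState.residual`, res-L1-repro-3 `…DepthMultiHostResidual.lean`: `S.K = M * S.residual.K`, M the member-wise minimal
  monomial). Phase C PUSHES THE RESIDUAL COSUPPORT INTO A FORMAT-SNC OPEN; at poles through a cone axis the residual is emptied by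
  order arithmetic (END is unreachable there, A9); E1 `isEndOn_of_isFormatSncOn` and T4 `IsEndOn.exists_centreSeq` are then applied
  VERBATIM to `S′.residual` (`isFormatSncOn_residual_iff`).
* **T5** `betaTwoMember_atomConclusion_of_targets : InitialMultiHost₂ → CJSTransport₂ → FormatEndOnCyl₂ → PhaseCTermination₂ →
  ∀ (β) d = 2 member, CORE binder` (pattern `atomConclusion_of_tower`, `…TowerContraction` l.114): concatenate the blow-ups of T2
  (`∃ Q, IsBlowup π Q ∧ supp Q ⊆ range cyl₀.j ⊆ range i = g⁻¹(closed point)`), T3 and T4 (centres over cosupp K ⊆ E-images ⊆ over the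
  closed point; tree `IsBlowup.exists_isBlowup_comp_supported`), read `I𝒪_top = M · K_top` from `DepthInvariant.exists_format` transported
  along the tower and `K_top = M′ · K♭_top` (A8); M, M′ pull back to locally principal ideals, K♭_top is principalised by E1+T4 on the
  residual state ⇒ `IsLocallyPrincipal`, top regular ⇒ CORE via `atomConclusion_of_tower`. `CJSTransport₂` is supplied as `transport_of_cjsB hlift hCJS` (pv-054) with `hlift` discharged by module 2
  (G11-21) and `hCJS : CossartJannsenSaito2020EmbeddedSequenceB` the ONLY named-fact binder of the composition.
-/

/-- [OURS · L1 W5.2 · F7(β) (β-AX) target C-I = `PhaseCOne` (res-L1-w52-plan-1 RULING G11-36; design owner res-L1-w52-idea-1, typer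
res-L1-w52-lead-1)] **Phase C-I reaches the residual END.** For the pole-atlas predicate `P`: a multi-host state `S` on regular excellent
Noetherian `X`, FORMAT-SNC on the cylinder region `cyl.V` and satisfying `P S cyl`, admits a finite sequence `s` of blowings up in REGULAR
centres over `cosupp S.K` with regular top, on which the transform of `K` FACTORS as `M · S₁.K` (`M` effective Cartier, `S₁` a multi-host
state with a summand) and the RESIDUAL state `S₁.residual` (`…DepthMultiHostResidual`) is at ideal-level END on some open `U ⊇ cosupp
S₁.residual.K` (`MultiHostState.IsEndOn`: `K♭|_U` is a sum of monomials in one global family with simple normal crossings on `U`).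
The binders up to `P S cyl →` are those of `PhaseCTermination₂` VERBATIM. **STRENGTH IS `P`΄s** (res-L1-w52-tri-2 audit v11.9b AE1): hosts are
arbitrary ideal sheaves bound by `CylState`/`IsFormatSncOn` on `cyl.V` ONLY, so at `P := ⊤` this statement (like `PhaseCTermination₂ ⊤`) is of
resolution strength; it is MEANT at `P := CylReach` (res-L1-w52-lead-1 `…DepthPhaseCAtlas`: the least step-stable initially-valid predicate), whose
clauses pin the state OFF `cyl.V` (cosupport inside `cyl.V ∪ ⋃ frozen strata`, host format on the frozen strata) — step-stable thanks to the v6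
lower bound in `StepStable`. -/
def PhaseCOne (P : ∀ ⦃X : Scheme.{u}⦄ (S : MultiHostState X), CylState S → Prop) : Prop :=
  ∀ {X : Scheme.{u}} [IsNoetherian X], Scheme.IsRegular X → Scheme.IsExcellent X →
  ∀ (S : MultiHostState X) (cyl : CylState S) [IsIntegral cyl.Z] [IsNoetherian cyl.Z],
    Scheme.IsRegular cyl.Z → S.n ≠ 0 →
  ∀ (𝓒 : List X.IdealSheafData) (𝓗 : Fin S.n → List (X.IdealSheafData × ℕ)),
    S.IsFormatSncOn cyl.V 𝓒 𝓗 → P S cyl →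
    ∃ (s : CentreSeq X), s.AllRegular ∧ s.CentresOver (S.K.support : Set X) ∧ Scheme.IsRegular s.top ∧
      ∃ (_ : IsNoetherian s.top) (M : s.top.IdealSheafData) (S₁ : MultiHostState s.top),
        S.K.comap s.comp = M * S₁.K ∧ IsEffectiveCartier M ∧ S₁.n ≠ 0 ∧
        ∃ (U : s.top.Opens), S₁.residual.IsEndOn U

end ChainW52F7BetaR

end Summit.ResolutionOfSingularities.ResolutionOfSingularities.Theorems

end
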